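import Summits.HodgeConjecture.HodgeConjecture.Theorems.F0P3KitFamilyOfRecord   -- ★ p822799 (K9 interface): `FrameData`, `kitFamilyOfRecord`, `isPinned_kitFamilyOfRecord`, `laws_kitFamilyOfRecord_of`, `letters_of_kitFamilyOfRecord` (+ ★ K7∕K7-ED.2)
import HarnessLib

/-!
# Crux `H413` — T5 ED. 4, **K9α** (RULING (V42)(ε), R-27): the SPECTRAL∕PACKET PACKAGE `SpecPkg` — the E-rows that read the sockets the anchor kit leaves blank, as ONE
# `structure … : Prop` over a kit — and `letters_of_specPkg`: the HJ3a line's two letters from `SpecPkg` at every frame + the remaining NAMED rows, over ★ `letters_of_kitFamilyOfRecord`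

F0∕P3 «U3-mult», cell `hodgecm-mathlib`, crux H413 (`stmt-HodgeConjecture-24833`).  RULING (V42) (F0P3-plan (g5), 12:26Z; REF1 R-27; F0P3b-plan (E1)–(E3)): at the pure anchor kit of T1 every
spectral socket is a placeholder, so the E-rows of ★ K7 (`h1 TraceIdentity`, the PACKET clauses of `h3 Factorisation`, `h4 MatchingS`, `h5 TransferS`, `h10 UnitaryPacket`, `h13 APacketSpectral`,
`h14 LocalExpansion`) are WITNESSED INSIDE the ONE rung-0 existential `Q_K9 … := QK0 … ∧ ∃ pk : SpecWitness, SpecPkg pk …` and never read off the anchor kit; K9β overrides the anchor's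
spectral fields by `Classical.choose` and the E-rows become PROJECTIONS of `choose_spec`.  THIS FILE (K9α) types the package KIT-GENERICALLY and threads it:
* §1 `ClassificationKit.FactorisationCls 𝔠` ∕ `.FactorisationPk 𝔠` — the CLASS conjunct (= letter TF «TraceFactorisation», K8-LETTERS §3) and the two PACKET conjuncts of ★ V6-B
  `Factorisation` (:65–:74) VERBATIM; `factorisation_of_cls_of_pk : FactorisationCls → FactorisationPk → Factorisation` and the converse projections.
* §2 **`structure ClassificationKit.SpecPkg (𝔠) : Prop`** — fields `factorisationPk`, `matchingS`, `transferS`, `aPacketSpectral`, `localExpansion` = ★ V6-B law texts BY NAME (the rows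
  that READ witness data; F0P3-plan 12:36:48Z: `TraceIdentity` is DERIVED from T1 at K9β and `UnitaryPacket` reads only tokens of record — both stay NAMED hypotheses outside the package;
  T1's S-class `SpecPkgT1 (𝔨 : ComparisonKit …)` lives in the Lines closer).
* §3 **`letters_of_specPkg 𝔇 (h : ∀ frame, (kitFamilyOfRecord 𝔇 frame).SpecPkg ∧ .TraceIdentity ∧ .FactorisationCls ∧ .SpectralSideGp ∧ .HatBounded ∧ .UnrStarAlgebra ∧ .LinIndepS ∧
  .UnitaryPacket ∧ .FlathDet ∧ .Routing ∧ JInfNoDegOne ∧ DsInfNoDegOne ∧ ‹AFA› ∧ .XiFamilyFin ∧ .XiUnram ∧ .EvpConvention) :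
  <StubE1coh body> ∧ Rogawski1990.hodgeTypeRigid`** := ★ `letters_of_kitFamilyOfRecord 𝔇 (laws_kitFamilyOfRecord_of 𝔇 fun frame => laws_kitOfRecord_of₂ …)` — every remaining row a NAMED
  per-frame hypothesis in the law's literal shape at `kitFamilyOfRecord 𝔇 frame` (h12 `FlathDet` and `hAF` leave the list and h15∕h22 gain the `IsCot` guards at the v7 books pass, RULING (V43)).
One `structure … : Prop` + two `def … : Prop` WITH BODIES (conjunct names) + theorems; no `sorry`, no named fact posited, no instance, no notation; `--supports stmt-HodgeConjecture-24833 --as helper`.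
HONEST LABEL: HC_CM is proved only modulo the printed citations until rung 0 closes.

References: [Rogawski1990] §13.7 p. 206, (14.2.1) p. 232, §14.3, §14.5 p. 237, §14.6 Thm. 14.6.4 pp. 236–244; [Flath1979] Thm. 3; [CartierCorvallis1979] §IV.
-/

set_option autoImplicit false
set_option linter.dupNamespace false

-- Mathlib idiom (★ (𝔤,K) files): commutator bracket on `Module.End ℂ M`, to MENTION the token binders of `StubE1coh`'s body.
attribute [local instance 100] LieRing.ofAssociativeRing

noncomputable section

open NumberField IsDedekindDomain MeasureTheory
open Literature.NumberTheory.Rogawski1990 Literature.NumberTheory.GaloisRepresentations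
open Literature.NumberTheory.Automorphic Literature.NumberTheory.Automorphic.UnitaryGroup
open Literature.NumberTheory.Automorphic.UnitaryGroup.CotangentForms
open Literature.RepresentationTheory.BorelWallach2000 Literature.RepresentationTheory.KonnoKonno2007
open scoped Matrix ComplexOrder

namespace Summit.HodgeConjecture.HodgeConjecture.Cruxes.H413.F0P3InnerFormClassificationV6.ClassificationKit

/-! ## §1 The class and packet conjuncts of `Factorisation` (kit-generic) -/

variable {L : Type} [Field L] [NumberField L] [IsCMField L] {H : Matrix (Fin 3) (Fin 3) L} {ι : L →+* ℂ} {T : GL (Fin 3) ℂ}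
  {hT : (T : Matrix (Fin 3) (Fin 3) ℂ)ᴴ * H.map ι * (T : Matrix (Fin 3) (Fin 3) ℂ) = Literature.Geometry.ComplexHyperbolic.BallModel.J}
  {μ : Measure (Gp L H).automorphicQuotient} [(Gp L H).IsAutomorphicMeasure μ] (𝔠 : ClassificationKit L H ι T hT μ)

/-- **The CLASS conjunct of (L7) `Factorisation`** (★ V6-B :66–:68 VERBATIM) — the content of letter TF «TraceFactorisation» (K8-LETTERS §3): `Tr π′(f′_{S,ι} ⊗ e_{Kc} ⊗ f^S) =
Tr π′_{S,ι}(f′_{S,ι}) · f^{S∧}(t(π′))` for `π′` unramified off `S` and `Kc`-trivial, `0` otherwise [FlathCorvallis1979 Thm. 3; Rogawski1990 §13.7 p. 206, §14.5 p. 237]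
(a kit PREDICATE — the kit `𝔠` is its explicit parameter). -/
def FactorisationCls (𝔠 : ClassificationKit L H ι T hT μ) : Prop :=
  ∀ (S : Finset (Places L)) (c : 𝔠.Cls) (fS : 𝔠.TestS S) (fT : 𝔠.Unr S),
    (𝔠.Adm S c → 𝔠.trGp c (𝔠.tens S fS fT) = 𝔠.chS S (𝔠.coordS S c) fS * 𝔠.hat S (germ L H S (𝔠.evp c)) fT) ∧
    (¬ 𝔠.Adm S c → 𝔠.trGp c (𝔠.tens S fS fT) = 0)

/-- **The two PACKET conjuncts of (L7) `Factorisation`** (★ V6-B :69–:74 VERBATIM) — on `G = U(Φ₃)` and `H = U(Φ₂) × U(Φ₁)`; they read the spectral sockets `trG trH` and the G∕H-side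
`S`-carriers, hence belong to the WITNESSED package (RULING (V42)) [FlathCorvallis1979 Thm. 3; CartierCorvallis1979 §IV; Rogawski1990 §13.2, §13.7 p. 206]
(a kit PREDICATE — the kit `𝔠` is its explicit parameter). -/
def FactorisationPk (𝔠 : ClassificationKit L H ι T hT μ) : Prop :=
  (∀ (S : Finset (Places L)) (Q : 𝔠.PacketG) (fSG : 𝔠.TestSG S) (fT : 𝔠.Unr S),
      (𝔠.ramG Q ⊆ S → 𝔠.trG Q (𝔠.tensG S fSG fT) = 𝔠.trGS S Q fSG * 𝔠.hat S (germ L H S (𝔠.evpG Q)) fT) ∧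
      (¬ 𝔠.ramG Q ⊆ S → 𝔠.trG Q (𝔠.tensG S fSG fT) = 0)) ∧
  (∀ (S : Finset (Places L)) (ρ : 𝔠.PacketH) (fSH : 𝔠.TestSH S) (fT : 𝔠.Unr S),
      (𝔠.ramH ρ ⊆ S → 𝔠.trH ρ (𝔠.tensH S fSH fT) = 𝔠.trHS S ρ fSH * 𝔠.hat S (germ L H S (𝔠.evpH ρ)) fT) ∧
      (¬ 𝔠.ramH ρ ⊆ S → 𝔠.trH ρ (𝔠.tensH S fSH fT) = 0))

/-- `Factorisation` from its class and packet conjuncts (and back). [cite: FlathCorvallis1979, Thm. 3] -/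
theorem factorisation_of_cls_of_pk (hc : 𝔠.FactorisationCls) (hp : 𝔠.FactorisationPk) : 𝔠.Factorisation := ⟨hc, hp.1, hp.2⟩

/-- The class conjunct of `Factorisation`. [cite: FlathCorvallis1979, Thm. 3] -/
theorem Factorisation.cls (h : 𝔠.Factorisation) : 𝔠.FactorisationCls := h.1

/-- The packet conjuncts of `Factorisation`. [cite: FlathCorvallis1979, Thm. 3] -/
theorem Factorisation.pk (h : 𝔠.Factorisation) : 𝔠.FactorisationPk := h.2

/-! ## §2 `SpecPkg` — the spectral∕packet package (the E-rows of ★ K7, witnessed inside `Q_K9` at K9β) -/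

/-- **`SpecPkg 𝔠`** (`𝔠.SpecPkg`) — ONE `Prop`-structure whose fields are EXACTLY the laws of ★ V6-B that read the sockets a pure anchor kit of T1 leaves as placeholders (`PacketG PacketH nG nH trG trH`,
the G∕H-side `S`-carriers, the ξ-packet data): the packet conjuncts of (L7) `Factorisation` [Flath1979 Thm. 3], `MatchingS` [(14.2.1), §14.3, Prop. 4.9.1], `TransferS` [§14.2 p. 228],
(L3) `APacketSpectral` [Thm. 13.3.7, §13.3] and (L6) `LocalExpansion` [Thm. 14.6.4 p. 244; Props. 14.4.1 (a), 14.4.2 (c)] — so that K9β's `Classical.choose` of `∃ pk, SpecPkg …` supplies them as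
PROJECTIONS (RULING (V42), REF1 R-27a).  NOT fields (F0P3-plan 12:36:48Z): `TraceIdentity` (DERIVED at K9β from T1's head at the overridden kit — never asserted inside `∃`) and `UnitaryPacket`
(reads only tokens of record; F0P3b's glue `unitaryPacket_kitOfRecord_of`).  T1's S-class laws T1c–T1f form `SpecPkgT1 (𝔨 : ComparisonKit …)` on the SAME witness — typed in the Lines closer
(Theorems cannot import T1's `ComparisonKit`) [Rogawski1990 §14.6 Thm. 14.6.1 p. 241, Thm. 14.6.4 p. 244, (14.2.1) p. 232]. -/
structure SpecPkg : Prop where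
  /-- (L7) on the packet sides -/
  factorisationPk : 𝔠.FactorisationPk
  /-- matching of factorised triples -/
  matchingS : 𝔠.MatchingS
  /-- transfer exists at every `f′_S` -/
  transferS : 𝔠.TransferS
  /-- (L3) A-packet spectral data on the quasi-split side (RUNG 5) -/
  aPacketSpectral : 𝔠.APacketSpectral
  /-- (L6) the local expansion of (14.6.3) (P3b: `localExpansion_kitOfRecord (hc) (hG) (hH)` at the kit of record) -/
  localExpansion : 𝔠.LocalExpansion

end Summit.HodgeConjecture.HodgeConjecture.Cruxes.H413.F0P3InnerFormClassificationV6.ClassificationKit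

namespace Summit.HodgeConjecture.HodgeConjecture.Cruxes.H413.F0P3KitOfRecord

open Summit.HodgeConjecture.HodgeConjecture.Cruxes.H413.F0P3InnerFormClassificationV6
open Summit.HodgeConjecture.HodgeConjecture.Cruxes.H413.F0P3XiArchPacketOfRecord (JInfNoDegOne DsInfNoDegOne)

/-! ## §3 K9α — the HJ3a line's letters from `SpecPkg` at every frame + the remaining named rows -/

/-- **K9α — `letters_of_specPkg`**: for a family `𝔇` of per-frame external data, IF at every letters' frame the kit of record satisfies the witnessed package `SpecPkg` and the remaining NAMED
rows — T1's head `TraceIdentity` (derived at K9β), TF (class factorisation), `SpectralSideGp`, `HatBounded`∕`UnrStarAlgebra` (★ from the pins at K9, not letters), (L2-SA) `LinIndepS`,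
`UnitaryPacket` (F0P3b's glue `unitaryPacket_kitOfRecord_of`), (L7-det) `FlathDet` (leaves at v7, RULING (V43)),
(L3′) `Routing`, the arch clauses `JInfNoDegOne`∕`DsInfNoDegOne`, «AFA» (leaves at v7), and the ξ-rows `XiFamilyFin`∕`XiUnram`∕`EvpConvention` (★ p822580 at `ξd := xiSideOfRecord …`) — THEN the
HJ3a line's two letters hold: `m(P) ≤ 1` on the cotangent locus at every compact CM frame, and E2′ `hodgeTypeRigid` (★ `letters_of_kitFamilyOfRecord` ∘ ★ `laws_kitFamilyOfRecord_of` ∘ ★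
`laws_kitOfRecord_of₂`). [cite: Rogawski1990, §14.6 Thm. 14.6.4 pp. 236–244; §15.3 ¶1; Prop. 15.2.1 (b)] [cite: BorelWallach2000, VI Thm. 4.11] -/
theorem letters_of_specPkg
    (𝔇 : ∀ (L : Type) [Field L] [NumberField L] [IsCMField L] (ι : L →+* ℂ) (H : Matrix (Fin 3) (Fin 3) L) (T : GL (Fin 3) ℂ)
      (hT : (T : Matrix (Fin 3) (Fin 3) ℂ)ᴴ * H.map ι * (T : Matrix (Fin 3) (Fin 3) ℂ) = Literature.Geometry.ComplexHyperbolic.BallModel.J),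
      (∀ τ' : L →+* ℂ, InfinitePlace.mk τ' ≠ InfinitePlace.mk ι → (H.map τ').PosDef) →
      2 ≤ Module.finrank ℚ ↥(maximalRealSubfield L) →
      ∀ (μ : Measure (Gp L H).automorphicQuotient) [(Gp L H).IsAutomorphicMeasure μ] (μω : HeckeCharacter L) (_hμu : μω.IsUnitary),
      (∀ x : Literature.NumberTheory.GaloisRepresentations.ideleGroup ↥(maximalRealSubfield L),
        μω (AdeleRing.ideleBaseChange (↥(maximalRealSubfield L)) L x) = quadraticHeckeCharCM L x) → FrameData L H ι T hT μ)
    (h : ∀ (L : Type) [Field L] [NumberField L] [IsCMField L] (ι : L →+* ℂ) (H : Matrix (Fin 3) (Fin 3) L) (T : GL (Fin 3) ℂ)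
      (hT : (T : Matrix (Fin 3) (Fin 3) ℂ)ᴴ * H.map ι * (T : Matrix (Fin 3) (Fin 3) ℂ) = Literature.Geometry.ComplexHyperbolic.BallModel.J)
      (hdef : ∀ τ' : L →+* ℂ, InfinitePlace.mk τ' ≠ InfinitePlace.mk ι → (H.map τ').PosDef) (h2 : 2 ≤ Module.finrank ℚ ↥(maximalRealSubfield L))
      (μ : Measure (Gp L H).automorphicQuotient) [(Gp L H).IsAutomorphicMeasure μ] (μω : HeckeCharacter L) (hμu : μω.IsUnitary)
      (hμω : ∀ x : Literature.NumberTheory.GaloisRepresentations.ideleGroup ↥(maximalRealSubfield L),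
        μω (AdeleRing.ideleBaseChange (↥(maximalRealSubfield L)) L x) = quadraticHeckeCharCM L x),
      -- the witnessed package (K9β: projections of `Classical.choose_spec`)
      (kitFamilyOfRecord 𝔇 L ι H T hT hdef h2 μ μω hμu hμω).SpecPkg ∧
      -- #1 (DERIVED from T1's head at the overridden kit, K9β), TF (class factorisation), #2, #6, #7, #8, #10, #12, #15
      (kitFamilyOfRecord 𝔇 L ι H T hT hdef h2 μ μω hμu hμω).TraceIdentity ∧
      (kitFamilyOfRecord 𝔇 L ι H T hT hdef h2 μ μω hμu hμω).FactorisationCls ∧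
      (kitFamilyOfRecord 𝔇 L ι H T hT hdef h2 μ μω hμu hμω).SpectralSideGp ∧
      (kitFamilyOfRecord 𝔇 L ι H T hT hdef h2 μ μω hμu hμω).HatBounded ∧
      (kitFamilyOfRecord 𝔇 L ι H T hT hdef h2 μ μω hμu hμω).UnrStarAlgebra ∧
      (kitFamilyOfRecord 𝔇 L ι H T hT hdef h2 μ μω hμu hμω).LinIndepS ∧
      (kitFamilyOfRecord 𝔇 L ι H T hT hdef h2 μ μω hμu hμω).UnitaryPacket ∧
      (kitFamilyOfRecord 𝔇 L ι H T hT hdef h2 μ μω hμu hμω).FlathDet ∧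
      (kitFamilyOfRecord 𝔇 L ι H T hT hdef h2 μ μω hμu hμω).Routing ∧
      -- the arch clauses on the family's `jInf dsInf` (R-22′), «AFA», and the ξ-rows #20 #21 #23
      JInfNoDegOne (𝔇 L ι H T hT hdef h2 μ μω hμu hμω).jInf ∧ DsInfNoDegOne (𝔇 L ι H T hT hdef h2 μ μω hμu hμω).dsInf ∧
      (∀ P : DiscreteAutomorphicRep (Gp L H) μ,
        ∃ (W : Type) (_ : AddCommGroup W) (_ : Module ℂ W)
          (σ : Representation ℂ (finAdelic (↥(maximalRealSubfield L)) L (IsCMField.complexConj L) 3 H) W),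
          σ.IsIrreducible ∧ σ.IsAdmissible ∧ P.HasFinComponent σ) ∧
      (kitFamilyOfRecord 𝔇 L ι H T hT hdef h2 μ μω hμu hμω).XiFamilyFin μω hμu ∧
      (kitFamilyOfRecord 𝔇 L ι H T hT hdef h2 μ μω hμu hμω).XiUnram ∧
      (kitFamilyOfRecord 𝔇 L ι H T hT hdef h2 μ μω hμu hμω).EvpConvention) :
    (∀ (L : Type) [Field L] [NumberField L] [IsCMField L] (ι : L →+* ℂ) (H : Matrix (Fin 3) (Fin 3) L) (T : GL (Fin 3) ℂ)
      (hT : (T : Matrix (Fin 3) (Fin 3) ℂ)ᴴ * H.map ι * (T : Matrix (Fin 3) (Fin 3) ℂ) = Literature.Geometry.ComplexHyperbolic.BallModel.J),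
      (∀ τ' : L →+* ℂ, InfinitePlace.mk τ' ≠ InfinitePlace.mk ι → (H.map τ').PosDef) →
      2 ≤ Module.finrank ℚ ↥(maximalRealSubfield L) →
      ∀ (μ : Measure (adelicGroupData (↥(maximalRealSubfield L)) L (IsCMField.complexConj L) 3 H).automorphicQuotient)
        [(adelicGroupData (↥(maximalRealSubfield L)) L (IsCMField.complexConj L) 3 H).IsAutomorphicMeasure μ]
        (P : DiscreteAutomorphicRep (adelicGroupData (↥(maximalRealSubfield L)) L (IsCMField.complexConj L) 3 H) μ),
        (P.IsHolCotangentAt (cmArchSection L ι H T hT) (cmCompactFactor L ι H T hT) ∨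
          P.IsAntiholCotangentAt (cmArchSection L ι H T hT) (cmCompactFactor L ι H T hT)) →
        ((adelicGroupData (↥(maximalRealSubfield L)) L (IsCMField.complexConj L) 3 H).rightRegular μ).multiplicity
            P.space.toContRep ≤ 1) ∧
    Literature.NumberTheory.Rogawski1990.hodgeTypeRigid := by
  refine letters_of_kitFamilyOfRecord 𝔇 (laws_kitFamilyOfRecord_of 𝔇 fun L _ _ _ ι H T hT hdef h2 μ _ μω hμu hμω => ?_)
  obtain ⟨hpk, h1, hTF, h2', h6, h7, h8, h10, h12, h15, hJ, hD, hAF, h20, h21, h23⟩ := h L ι H T hT hdef h2 μ μω hμu hμω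
  letI : MeasurableSpace (Gp L H).Adelic := borel _
  haveI : BorelSpace (Gp L H).Adelic := ⟨rfl⟩
  haveI := (𝔇 L ι H T hT hdef h2 μ μω hμu hμω).isFiniteMeasureOnCompacts_ν
  exact laws_kitOfRecord_of₂ L H ι T hT μ _ _ _ μω hμu _ _ _ _ _ _ _ hdef h2 h1 h2'
    (ClassificationKit.factorisation_of_cls_of_pk _ hTF hpk.factorisationPk) hpk.matchingS hpk.transferS h6 h7 h8 h10 h12 hpk.aPacketSpectral
    hpk.localExpansion h15 hμω hJ hD hAF h20 h21 h23

end Summit.HodgeConjecture.HodgeConjecture.Cruxes.H413.F0P3KitOfRecord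

end
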